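import Summits.NavierStokesRegularity.NavierStokesRegularity.Theorems.FilamentSkeletonRssDefectColumnGateBorderedAssembly
import Summits.NavierStokesRegularity.NavierStokesRegularity.Theorems.FilamentSkeletonRssKelvinGatePerturbation

/-!
# Route `FilamentSkeletonRss` · ∀-support item `TransverseReduction1ARmod` (stmt-NavierStokesRegularity-23920) · line `defect_column_gate_1AR_mod`,
# stub S2b-mod `GateAssemblyLocMod`: the bordered gate spec `DefectGateSpecAcc` is STABLE under X-small perturbations of the base family — ALL FOUR clauses

Helper file (theorems only), `--supports stmt-NavierStokesRegularity-23920 --as helper` (also serves 23611); LEAD of 23611 / registrar of 23920,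
lane ns-filament-21221-p1 g14.

THE LEMMA (`DefectGateSpecAcc.perturb_base`).  Let `(𝓚, 𝓠, 𝓫, 𝓬)` satisfy `DefectGateSpecAcc N Γ κ C₂ β₀ α0 U⁰ Z D` — a right inverse of
`𝓛_(α⁰_p+β, U⁰_{p,β}) + ∇` bordered by the rate column `Z_{p,β}` and the `N` accretion modes `D_{p,1…N}`, Y-scale → X-scale with norm `A = C₂Γ^κ`, linear,
TIGHT uniformly on the box, LOCALLY CONTINUOUS in `(p, β)` — and let `V_{p,β}` be a perturbation of the base family which is X-bounded by `ν` with
`8·C₂Γ^κ·ν ≤ 1` on the whole box and locally continuous in `(p, β)` (local `C¹` closeness on balls, the topology of clause (4)).  Then the base family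
`U⁰ + V` carries a bordered gate with ALL FOUR clauses of `DefectGateSpecAcc` and constant `2C₂`.

PROOF.  `𝓛_(α, U⁰+V) W = 𝓛_(α, U⁰) W + (DW[V] + DV[W])` (`lerayLin_add_base`, p-file `…KelvinGatePerturbation`), so the OLD gate is an APPROXIMATE bordered gate
for the NEW base with defect `R F := −(D(𝓚F)[V] + DV[𝓚F])`, which contracts the Y-scale by `θ = 4C₂Γ^κ·ν ≤ ½` (`XBound.yBound_fderiv_apply`), is linear,
is tight in values (`|RF| ≤ |D𝓚F|·|V| + |DV|·|𝓚F| ≤ 2ν·ε` on balls where the gate is tight) and is locally continuous in `(p, β)` (four-term splitting against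
the local continuity of `𝓚` and of `V`); the landed ASSEMBLY INTERFACE `defectGateSpecAcc_of_approximate` (p681316) then conjugates by the Neumann solution
operator and delivers all four clauses.  This completes, for the bordered spec, what `GateSpec.perturb_core` (clauses (1)(2) only, one-border spec) left open.

USE (recorded, not claimed).  In S2b-mod the gate is to be built at REFERENCE data and transported: X-close bases of the same box (dressing corrections of
higher order, the closing correction `𝓚G` of S3-mod, frozen-coefficient steps of a continuity method in an X-small direction) share their bordered gates up to
the factor 2, with tightness and parameter-continuity preserved — the two clauses S3-mod's joint continuity of the multipliers `(g, B)` consumes.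
HONEST FRAMING: functional-analytic bookkeeping for a HYPOTHETICAL filament-type rotating-self-similar blow-up route (MODEL rung, negative side, SUPPORT
item); the ANALYTIC content of S2b-mod (sectional inverses, far-field resolvent, patching) is untouched and OPEN; nothing here bears on Navier–Stokes
regularity, which is NOT proved.
-/

set_option linter.dupNamespace false

noncomputable section

namespace Summit.NavierStokesRegularity.NavierStokesRegularity.Theorems.DefectColumnGate

open scoped BigOperators Topology InnerProductSpace ContDiff
open Filter Set Function MeasureTheory Metric
open Literature.Analysis.FluidPDE
open Summit.NavierStokesRegularity.NavierStokesRegularity.Theorems.KelvinGate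

/-- Pointwise size of the base-change operator `T W := DW[V] + DV[W]` in values: `‖DW(y)[V(y)] + DV(y)[W(y)]‖ ≤ ‖DW(y)‖·ν + ν·‖W(y)‖` for `V` X-bounded by `ν`. -/
theorem norm_baseChange_le {V W : EuclideanSpace ℝ (Fin 3) → EuclideanSpace ℝ (Fin 3)} {ν : ℝ} (hV : XBound V ν) (y : EuclideanSpace ℝ (Fin 3)) :
    ‖fderiv ℝ W y (V y) + fderiv ℝ V y (W y)‖ ≤ ‖fderiv ℝ W y‖ * ν + ν * ‖W y‖ := by
  obtain ⟨hv, hdv⟩ := hV.norm_le' y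
  calc ‖fderiv ℝ W y (V y) + fderiv ℝ V y (W y)‖
      ≤ ‖fderiv ℝ W y (V y)‖ + ‖fderiv ℝ V y (W y)‖ := norm_add_le _ _
    _ ≤ ‖fderiv ℝ W y‖ * ‖V y‖ + ‖fderiv ℝ V y‖ * ‖W y‖ :=
        add_le_add (ContinuousLinearMap.le_opNorm _ _) (ContinuousLinearMap.le_opNorm _ _)
    _ ≤ ‖fderiv ℝ W y‖ * ν + ν * ‖W y‖ :=
        add_le_add (mul_le_mul_of_nonneg_left hv (norm_nonneg _)) (mul_le_mul_of_nonneg_right hdv (norm_nonneg _))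

/-- Four-term splitting of the base-change operator across two parameters:
`‖(DW′[V′] + DV′[W′]) − (DW[V] + DV[W])‖ ≤ ‖DW′ − DW‖·‖V′‖ + ‖DW‖·‖V′ − V‖ + ‖DV′ − DV‖·‖W′‖ + ‖DV‖·‖W′ − W‖` (pointwise). -/
theorem norm_baseChange_sub_le (V V' W W' : EuclideanSpace ℝ (Fin 3) → EuclideanSpace ℝ (Fin 3)) (y : EuclideanSpace ℝ (Fin 3)) :
    ‖(fderiv ℝ W' y (V' y) + fderiv ℝ V' y (W' y)) - (fderiv ℝ W y (V y) + fderiv ℝ V y (W y))‖ ≤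
      ‖fderiv ℝ W' y - fderiv ℝ W y‖ * ‖V' y‖ + ‖fderiv ℝ W y‖ * ‖V' y - V y‖ +
        ‖fderiv ℝ V' y - fderiv ℝ V y‖ * ‖W' y‖ + ‖fderiv ℝ V y‖ * ‖W' y - W y‖ := by
  have e : (fderiv ℝ W' y (V' y) + fderiv ℝ V' y (W' y)) - (fderiv ℝ W y (V y) + fderiv ℝ V y (W y)) =
      (fderiv ℝ W' y - fderiv ℝ W y) (V' y) + fderiv ℝ W y (V' y - V y) +
        ((fderiv ℝ V' y - fderiv ℝ V y) (W' y) + fderiv ℝ V y (W' y - W y)) := by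
    simp only [FunLike.coe_sub, Pi.sub_apply, map_sub]
    abel
  rw [e]
  calc ‖(fderiv ℝ W' y - fderiv ℝ W y) (V' y) + fderiv ℝ W y (V' y - V y) +
          ((fderiv ℝ V' y - fderiv ℝ V y) (W' y) + fderiv ℝ V y (W' y - W y))‖
      ≤ ‖(fderiv ℝ W' y - fderiv ℝ W y) (V' y) + fderiv ℝ W y (V' y - V y)‖ +
          ‖(fderiv ℝ V' y - fderiv ℝ V y) (W' y) + fderiv ℝ V y (W' y - W y)‖ := norm_add_le _ _
    _ ≤ (‖(fderiv ℝ W' y - fderiv ℝ W y) (V' y)‖ + ‖fderiv ℝ W y (V' y - V y)‖) +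
          (‖(fderiv ℝ V' y - fderiv ℝ V y) (W' y)‖ + ‖fderiv ℝ V y (W' y - W y)‖) :=
        add_le_add (norm_add_le _ _) (norm_add_le _ _)
    _ ≤ (‖fderiv ℝ W' y - fderiv ℝ W y‖ * ‖V' y‖ + ‖fderiv ℝ W y‖ * ‖V' y - V y‖) +
          (‖fderiv ℝ V' y - fderiv ℝ V y‖ * ‖W' y‖ + ‖fderiv ℝ V y‖ * ‖W' y - W y‖) :=
        add_le_add (add_le_add (ContinuousLinearMap.le_opNorm _ _) (ContinuousLinearMap.le_opNorm _ _))
          (add_le_add (ContinuousLinearMap.le_opNorm _ _) (ContinuousLinearMap.le_opNorm _ _))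
    _ = _ := by ring

/-- **`DefectGateSpecAcc` is stable under X-small, locally continuous perturbations of the base family (all four clauses, constant doubled).**
If `(𝓚, 𝓠, 𝓫, 𝓬)` satisfies `DefectGateSpecAcc N Γ κ C₂ β₀ α0 U⁰ Z D`, the base fields `U⁰_{p,β}` are differentiable, and `V_{p,β}` is X-bounded by `ν` with
`8·(C₂Γ^κ)·ν ≤ 1` at every `(p, β)` of the box and locally continuous in `(p, β)` there, then some `(𝓚′, 𝓠′, 𝓫′, 𝓬′)` satisfies
`DefectGateSpecAcc N Γ κ (2C₂) β₀ α0 (U⁰ + V) Z D`.  (Construction: the old gate conjugated by the Neumann solution operator of `F′ = F + (D(𝓚F′)[V] + DV[𝓚F′])`,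
through `defectGateSpecAcc_of_approximate`.) -/
theorem DefectGateSpecAcc.perturb_base {N : ℕ} {Γ κ C₂ β₀ ν : ℝ} {α0 : (Fin N → ℝ) → ℝ}
    {U0 V Z : (Fin N → ℝ) → ℝ → EuclideanSpace ℝ (Fin 3) → EuclideanSpace ℝ (Fin 3)} {D : (Fin N → ℝ) → Fin N → EuclideanSpace ℝ (Fin 3) → EuclideanSpace ℝ (Fin 3)}
    {𝓚 : (Fin N → ℝ) → ℝ → (EuclideanSpace ℝ (Fin 3) → EuclideanSpace ℝ (Fin 3)) → EuclideanSpace ℝ (Fin 3) → EuclideanSpace ℝ (Fin 3)}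
    {𝓠 : (Fin N → ℝ) → ℝ → (EuclideanSpace ℝ (Fin 3) → EuclideanSpace ℝ (Fin 3)) → EuclideanSpace ℝ (Fin 3) → ℝ}
    {𝓫 : (Fin N → ℝ) → ℝ → (EuclideanSpace ℝ (Fin 3) → EuclideanSpace ℝ (Fin 3)) → ℝ}
    {𝓬 : (Fin N → ℝ) → ℝ → (EuclideanSpace ℝ (Fin 3) → EuclideanSpace ℝ (Fin 3)) → Fin N → ℝ}
    (hgate : DefectGateSpecAcc N Γ κ C₂ β₀ α0 U0 Z D 𝓚 𝓠 𝓫 𝓬)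
    (hU0 : ∀ p : Fin N → ℝ, (∀ i, p i ∈ Icc (0:ℝ) 1) → ∀ β : ℝ, |β| ≤ β₀ → Differentiable ℝ (U0 p β))
    (hV : ∀ p : Fin N → ℝ, (∀ i, p i ∈ Icc (0:ℝ) 1) → ∀ β : ℝ, |β| ≤ β₀ → XBound (V p β) ν)
    (hν : 8 * (C₂ * Γ ^ κ) * ν ≤ 1)
    (hVc : ∀ p : Fin N → ℝ, (∀ i, p i ∈ Icc (0:ℝ) 1) → ∀ β : ℝ, |β| ≤ β₀ → ∀ L ε : ℝ, 0 < ε → ∃ δ' : ℝ, 0 < δ' ∧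
      ∀ p' : Fin N → ℝ, (∀ i, p' i ∈ Icc (0:ℝ) 1) → ∀ β' : ℝ, |β'| ≤ β₀ → dist p' p < δ' → |β' - β| < δ' → LocClose (V p' β') (V p β) L ε) :
    ∃ (𝓚' : (Fin N → ℝ) → ℝ → (EuclideanSpace ℝ (Fin 3) → EuclideanSpace ℝ (Fin 3)) → EuclideanSpace ℝ (Fin 3) → EuclideanSpace ℝ (Fin 3))
      (𝓠' : (Fin N → ℝ) → ℝ → (EuclideanSpace ℝ (Fin 3) → EuclideanSpace ℝ (Fin 3)) → EuclideanSpace ℝ (Fin 3) → ℝ)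
      (𝓫' : (Fin N → ℝ) → ℝ → (EuclideanSpace ℝ (Fin 3) → EuclideanSpace ℝ (Fin 3)) → ℝ)
      (𝓬' : (Fin N → ℝ) → ℝ → (EuclideanSpace ℝ (Fin 3) → EuclideanSpace ℝ (Fin 3)) → Fin N → ℝ),
      DefectGateSpecAcc N Γ κ (2 * C₂) β₀ α0 (fun p β y => U0 p β y + V p β y) Z D 𝓚' 𝓠' 𝓫' 𝓬' := by
  obtain ⟨h12, h3, h4⟩ := hgate
  -- shorthand
  set A : ℝ := C₂ * Γ ^ κ with hAdef
  set θ : ℝ := 4 * (C₂ * Γ ^ κ) * ν with hθdef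
  have hθ : θ ≤ 1 / 2 := by rw [hθdef]; linarith
  have hA : 2 * A ≤ 2 * C₂ * Γ ^ κ := by rw [hAdef]; exact le_of_eq (by ring)
  -- the defect `R F := −(D(𝓚F)[V] + DV[𝓚F])`
  set Rm : (Fin N → ℝ) → ℝ → (EuclideanSpace ℝ (Fin 3) → EuclideanSpace ℝ (Fin 3)) → EuclideanSpace ℝ (Fin 3) → EuclideanSpace ℝ (Fin 3) :=
    fun p β F y => -(fderiv ℝ (𝓚 p β F) y (V p β y) + fderiv ℝ (V p β) y (𝓚 p β F y)) with hRm
  refine defectGateSpecAcc_of_approximate (U0 := fun p β y => U0 p β y + V p β y) 𝓚 Rm 𝓠 𝓫 𝓬 hA hθ ?_ ?_ ?_ ?_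
  · -- (h1) bounds, divergence, the contracting defect and the equation for the new base
    intro p hp β hβ F R hF
    obtain ⟨hX, hQ1, hQb, hbb, hcb, hdiv, heq⟩ := (h12 p hp β hβ).1 F R hF
    have hVX : XBound (V p β) ν := hV p hp β hβ
    refine ⟨hX, hQ1, hQb, hbb, hcb, hdiv, ?_, fun y => ?_⟩
    · -- `Y(RF) ≤ 4·C₂Γ^κ·ν·R`
      have h1 := hX.yBound_fderiv_apply hVX
      have h2 := hVX.yBound_fderiv_apply hX
      have h := (h1.add h2).neg
      refine h.mono (le_of_eq ?_)
      rw [hθdef]; ring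
    · -- the equation: the base-change term cancels the defect
      have hdU : DifferentiableAt ℝ (U0 p β) y := hU0 p hp β hβ y
      have hdV : DifferentiableAt ℝ (V p β) y := hVX.1.differentiable (by norm_num) y
      have e := lerayLin_add_base (α0 p + β) (U0 p β) (V p β) (𝓚 p β F) y hdU hdV
      show lerayLin (α0 p + β) (fun y => U0 p β y + V p β y) (𝓚 p β F) y + gradient (𝓠 p β F) y + 𝓫 p β F • Z p β y +
          ∑ j, 𝓬 p β F j • D p j y + -(fderiv ℝ (𝓚 p β F) y (V p β y) + fderiv ℝ (V p β) y (𝓚 p β F y)) = F y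
      rw [e, ← heq y]
      abel
  · -- (h2) linearity of `𝓚, 𝓫, 𝓬` (given) and of the defect
    intro p hp β hβ F H s hF hH
    obtain ⟨hK, hb, hc⟩ := (h12 p hp β hβ).2 F H s hF hH
    refine ⟨hK, hb, hc, ?_⟩
    obtain ⟨R, hFR⟩ := hF
    obtain ⟨R', hHR⟩ := hH
    have hXF : XBound (𝓚 p β F) (C₂ * Γ ^ κ * R) := ((h12 p hp β hβ).1 F R hFR).1
    have hXH : XBound (𝓚 p β H) (C₂ * Γ ^ κ * R') := ((h12 p hp β hβ).1 H R' hHR).1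
    funext y
    show -(fderiv ℝ (𝓚 p β (fun y => F y + s • H y)) y (V p β y) + fderiv ℝ (V p β) y (𝓚 p β (fun y => F y + s • H y) y)) =
      -(fderiv ℝ (𝓚 p β F) y (V p β y) + fderiv ℝ (V p β) y (𝓚 p β F y)) +
        s • -(fderiv ℝ (𝓚 p β H) y (V p β y) + fderiv ℝ (V p β) y (𝓚 p β H y))
    rw [hK]
    have hdF : DifferentiableAt ℝ (𝓚 p β F) y := hXF.1.differentiable (by norm_num) y
    have hdH : DifferentiableAt ℝ (𝓚 p β H) y := hXH.1.differentiable (by norm_num) y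
    have hdsH : DifferentiableAt ℝ (fun y => s • 𝓚 p β H y) y := hdH.fun_const_smul s
    show -(fderiv ℝ (fun y => 𝓚 p β F y + s • 𝓚 p β H y) y (V p β y) + fderiv ℝ (V p β) y (𝓚 p β F y + s • 𝓚 p β H y)) =
      -(fderiv ℝ (𝓚 p β F) y (V p β y) + fderiv ℝ (V p β) y (𝓚 p β F y)) +
        s • -(fderiv ℝ (𝓚 p β H) y (V p β y) + fderiv ℝ (V p β) y (𝓚 p β H y))
    rw [fderiv_fun_add hdF hdsH, fderiv_fun_const_smul hdH]
    have e3 : (fderiv ℝ (𝓚 p β F) y + s • fderiv ℝ (𝓚 p β H) y) (V p β y) =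
        fderiv ℝ (𝓚 p β F) y (V p β y) + s • fderiv ℝ (𝓚 p β H) y (V p β y) := rfl
    rw [e3, map_add, map_smul, smul_neg, smul_add]
    abel
  · -- (h3) tightness: the gate's, plus `|RF| ≤ 2ν·ε₁` on the ball
    intro R L ε hε
    set ε₁ : ℝ := ε / (2 * |ν| + 1) with hε₁
    have hden : 0 < 2 * |ν| + 1 := by positivity
    have hε₁pos : 0 < ε₁ := div_pos hε hden
    have hε₁le : ε₁ ≤ ε := by
      rw [hε₁, div_le_iff₀ hden]; nlinarith [abs_nonneg ν]
    have h2νε₁ : 2 * |ν| * ε₁ ≤ ε := by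
      rw [hε₁, mul_div_assoc', div_le_iff₀ hden]; nlinarith [abs_nonneg ν]
    obtain ⟨L', δ₀, hδ₀, h3'⟩ := h3 R L ε₁ hε₁pos
    refine ⟨L', δ₀, hδ₀, fun p hp β hβ F hF hsm => ?_⟩
    obtain ⟨hK, hb, hc⟩ := h3' p hp β hβ F hF hsm
    have hVX : XBound (V p β) ν := hV p hp β hβ
    have hν0 : 0 ≤ ν := hVX.nonneg
    have hνa : ν = |ν| := (abs_of_nonneg hν0).symm
    refine ⟨fun y hy => ⟨(hK y hy).1.trans hε₁le, (hK y hy).2.trans hε₁le⟩, hb.trans hε₁le, fun j => (hc j).trans hε₁le, fun y hy => ?_⟩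
    show ‖-(fderiv ℝ (𝓚 p β F) y (V p β y) + fderiv ℝ (V p β) y (𝓚 p β F y))‖ ≤ ε
    rw [norm_neg]
    calc ‖fderiv ℝ (𝓚 p β F) y (V p β y) + fderiv ℝ (V p β) y (𝓚 p β F y)‖
        ≤ ‖fderiv ℝ (𝓚 p β F) y‖ * ν + ν * ‖𝓚 p β F y‖ := norm_baseChange_le hVX y
      _ ≤ ε₁ * ν + ν * ε₁ := add_le_add (mul_le_mul_of_nonneg_right (hK y hy).2 hν0) (mul_le_mul_of_nonneg_left (hK y hy).1 hν0)
      _ = 2 * |ν| * ε₁ := by rw [← hνa]; ring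
      _ ≤ ε := h2νε₁
  · -- (h4) local continuity in `(p, β)`: the gate's, plus the four-term splitting for the defect
    intro p hp β hβ F R L ε hF hε
    have hVX : XBound (V p β) ν := hV p hp β hβ
    have hν0 : 0 ≤ ν := hVX.nonneg
    have hXF : XBound (𝓚 p β F) (A * R) := ((h12 p hp β hβ).1 F R hF).1
    have hAR : 0 ≤ A * R := hXF.nonneg
    set ε₁ : ℝ := ε / (4 * ν + 1) with hε₁
    set ε₂ : ℝ := ε / (4 * (A * R) + 1) with hε₂
    have hd1 : 0 < 4 * ν + 1 := by linarith
    have hd2 : 0 < 4 * (A * R) + 1 := by linarith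
    have hε₁pos : 0 < ε₁ := div_pos hε hd1
    have hε₂pos : 0 < ε₂ := div_pos hε hd2
    have hε₁le : ε₁ ≤ ε := by rw [hε₁, div_le_iff₀ hd1]; nlinarith
    have hνε₁ : 2 * ν * ε₁ ≤ ε / 2 := by
      rw [hε₁, mul_div_assoc', div_le_iff₀ hd1]; nlinarith
    have hAε₂ : 2 * (A * R) * ε₂ ≤ ε / 2 := by
      rw [hε₂, mul_div_assoc', div_le_iff₀ hd2]; nlinarith
    obtain ⟨δ₁, hδ₁, h4'⟩ := h4 p hp β hβ F R L ε₁ hF hε₁pos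
    obtain ⟨δ₂, hδ₂, hVc'⟩ := hVc p hp β hβ L ε₂ hε₂pos
    refine ⟨min δ₁ δ₂, lt_min hδ₁ hδ₂, fun p' hp' β' hβ' hdp hdβ => ?_⟩
    obtain ⟨hK, hb, hc⟩ := h4' p' hp' β' hβ' (hdp.trans_le (min_le_left _ _)) (hdβ.trans_le (min_le_left _ _))
    have hVl := hVc' p' hp' β' hβ' (hdp.trans_le (min_le_right _ _)) (hdβ.trans_le (min_le_right _ _))
    have hVX' : XBound (V p' β') ν := hV p' hp' β' hβ'
    have hXF' : XBound (𝓚 p' β' F) (A * R) := ((h12 p' hp' β' hβ').1 F R hF).1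
    refine ⟨fun y hy => ⟨(hK y hy).1.trans hε₁le, (hK y hy).2.trans hε₁le⟩, hb.trans hε₁le, fun j => (hc j).trans hε₁le, fun y hy => ?_⟩
    show ‖-(fderiv ℝ (𝓚 p' β' F) y (V p' β' y) + fderiv ℝ (V p' β') y (𝓚 p' β' F y)) -
        -(fderiv ℝ (𝓚 p β F) y (V p β y) + fderiv ℝ (V p β) y (𝓚 p β F y))‖ ≤ ε
    rw [neg_sub_neg, norm_sub_rev]
    obtain ⟨hKv, hKd⟩ := hK y hy
    obtain ⟨hVv, hVd⟩ := hVl y hy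
    obtain ⟨hv', -⟩ := hVX'.norm_le' y
    obtain ⟨-, hdv⟩ := hVX.norm_le' y
    obtain ⟨hk', -⟩ := hXF'.norm_le' y
    obtain ⟨-, hdk⟩ := hXF.norm_le' y
    calc ‖(fderiv ℝ (𝓚 p' β' F) y (V p' β' y) + fderiv ℝ (V p' β') y (𝓚 p' β' F y)) -
            (fderiv ℝ (𝓚 p β F) y (V p β y) + fderiv ℝ (V p β) y (𝓚 p β F y))‖
        ≤ ‖fderiv ℝ (𝓚 p' β' F) y - fderiv ℝ (𝓚 p β F) y‖ * ‖V p' β' y‖ + ‖fderiv ℝ (𝓚 p β F) y‖ * ‖V p' β' y - V p β y‖ +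
            ‖fderiv ℝ (V p' β') y - fderiv ℝ (V p β) y‖ * ‖𝓚 p' β' F y‖ + ‖fderiv ℝ (V p β) y‖ * ‖𝓚 p' β' F y - 𝓚 p β F y‖ :=
          norm_baseChange_sub_le _ _ _ _ y
      _ ≤ ε₁ * ν + (A * R) * ε₂ + ε₂ * (A * R) + ν * ε₁ := by
          gcongr
      _ = 2 * ν * ε₁ + 2 * (A * R) * ε₂ := by ring
      _ ≤ ε / 2 + ε / 2 := add_le_add hνε₁ hAε₂
      _ = ε := by ring

end Summit.NavierStokesRegularity.NavierStokesRegularity.Theorems.DefectColumnGate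

end
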